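import Mathlib
import Summits.SmoothPoincare4.SmoothPoincare4.Theorems.ConvexBisectionAcyclicBisectionExistsMultiAttachmentHomologyMV
import Summits.SmoothPoincare4.SmoothPoincare4.Theorems.ConvexBisectionAcyclicBisectionExistsMultiAttachmentHomologyLoops
import HarnessLib

/-!
# `Hₖ`, `k ≥ 2`, of a space covered by an open piece `A` and finitely many disjoint acyclic
# open pieces with independent edge classes: `Hₖ(A) ≅ Hₖ(X)`
(helper for stub `stub_isLefschetzHandlebody_homology` = NF5
`Literature.Topology.FourManifolds.LefschetzBase.isLefschetzHandlebody_homology`, line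
`modp-braid-orbits` r9, crux `ConvexBisection.AcyclicBisectionExists`, item stmt-SmoothPoincare4-10508;
wave 3 / W3-2: the COVER half of E2 = `Hₖ(V ∪ 2-handles) ≅ Hₖ(V)` for `k ≥ 3`, and for `k = 2`
when the attaching classes are linearly independent — the input of clause 3 of NF5,
ℚ-acyclicity of `X(F; l)` when the `2g` vanishing cycles span `H₁(F; ℚ)`)

For Kosinski's cover `A = jA(V ∖ ⋃ cores)`, `Bᵢ = jBᵢ(D⁴ ∖ S)` of a multi-attachment of
2-handles (`Bᵢ` contractible, `A ∩ Bᵢ ≃ S¹`), the Mayer–Vietoris sequence of each step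
`U ↦ U ∪ Bᵢ` reads `0 → Hₖ(U) → Hₖ(U ∪ Bᵢ) → Hₖ₋₁(S¹) → Hₖ₋₁(U)` (Hatcher 2002, §2.2 p. 149), so
`Hₖ(U) ≅ Hₖ(U ∪ Bᵢ)` for `k ≥ 3`, and for `k = 2` as soon as `H₁(S¹) → H₁(U)` is injective,
i.e. the `i`-th attaching class is independent of the previous ones in `H₁(A)`
(Gompf–Stipsicz 1999, §4.4: `H₂(X ∪ 2-handles)` grows exactly by the relations among the
attaching circles).  Abstractly:

* **`ker_and_isIso_finset`, `isIso_map_add_two_cover`** — for `X = A ∪ ⋃ᵢ Bᵢ` with `A`, `Bᵢ`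
  open, the `Bᵢ` pairwise disjoint, path connected and acyclic in positive degrees, the
  `A ∩ Bᵢ` path connected with `Hₖ(A ∩ Bᵢ) = 0` for `k ≥ 2`, `H₁(A ∩ Bᵢ) → H₁(A)` injective with
  image `R ∙ cᵢ`, and the family `c` linearly independent: `Hₖ₊₂(A; R) ≅ Hₖ₊₂(X; R)` by the
  inclusion, for every `k`;
* the registered sub-goal stub `stub_multiAttachment_coverHk`.

Everything is proved; no named facts, no `sorry`, no definitions.  References: A. Hatcher,
*Algebraic Topology* (2002), §2.2 pp. 149–150 [HatcherAT2002]; R. E. Gompf, A. I. Stipsicz,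
*4-Manifolds and Kirby Calculus* (1999), §4.4 [GompfStipsicz1999].
-/

noncomputable section

-- the prescribed namespace `Summit.<P>.<Sub>.…` duplicates `SmoothPoincare4` (P = Sub)
set_option linter.dupNamespace false

open Set Function CategoryTheory CategoryTheory.Limits
open Literature.AlgebraicTopology.SingularHomology

namespace Summit.SmoothPoincare4.SmoothPoincare4.Theorems.AcyclicBisectionExists.ModpBraidOrbits

universe u v

variable (R : Type v) [CommRing R] {X : Type u} [TopologicalSpace X]

/-! ## §1 Bookkeeping of inclusions -/

/-- Mutually inclusive subsets have isomorphic homology by the inclusion. [folklore] -/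
private theorem isIso_map_incl_of_subset {A B : Set X} (hAB : A ⊆ B) (hBA : B ⊆ A) (n : ℕ) :
    IsIso (singularHomology.map R R (subsetInclusion hAB) n) := by
  refine ⟨⟨singularHomology.map R R (subsetInclusion hBA) n, ?_, ?_⟩⟩ <;>
  · rw [← singularHomology.map_comp]
    exact (congrArg (singularHomology.map R R · n) (by ext x; rfl)).trans
      (singularHomology.map_id R R n)

/-- `Hₙ(univ) ≅ Hₙ(X)` by the inclusion. [folklore] -/
private theorem isIso_map_incl_univ (n : ℕ) :
    IsIso (singularHomology.map R R (subsetIncl (univ : Set X)) n) := by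
  rw [show subsetIncl (univ : Set X) = (Homeomorph.Set.univ X : C(↥(univ : Set X), X)) by ext x; rfl,
    ← singularHomology.mapIso_hom]
  infer_instance

/-- Monomorphy of the inclusion on homology only depends on the subset. [folklore] -/
theorem mono_map_congr_set {S T P : Set X} (hST : S = T) (hS : S ⊆ P) (hT : T ⊆ P) (n : ℕ)
    (h : Mono (singularHomology.map R R (subsetInclusion hT) n)) :
    Mono (singularHomology.map R R (subsetInclusion hS) n) := by
  subst hST; exact h

/-- Vanishing of homology only depends on the subset. [folklore] -/
theorem isZero_congr_set {S T : Set X} (hST : S = T) (n : ℕ)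
    (h : IsZero (singularHomology R R ↥T n)) : IsZero (singularHomology R R ↥S n) := by
  subst hST; exact h

/-- Equal subsets of `P` have the same image in `Hₙ(P)`. [folklore] -/
private theorem range_congr_set {S T P : Set X} (hST : S = T) (hS : S ⊆ P) (hT : T ⊆ P) (n : ℕ) :
    LinearMap.range (singularHomology.map R R (subsetInclusion hS) n).hom =
      LinearMap.range (singularHomology.map R R (subsetInclusion hT) n).hom := by
  subst hST; rfl

/-- Composition of inclusions on homology, on `hom`s. [folklore] -/
private theorem hom_comp_incl {S P Q : Set X} (hSP : S ⊆ P) (hPQ : P ⊆ Q) (n : ℕ) :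
    (singularHomology.map R R (subsetInclusion (hSP.trans hPQ)) n).hom =
      (singularHomology.map R R (subsetInclusion hPQ) n).hom ∘ₗ
        (singularHomology.map R R (subsetInclusion hSP) n).hom := by
  rw [← ModuleCat.hom_comp, ← singularHomology.map_comp]; rfl

/-! ## §2 The iterated Mayer–Vietoris steps in degrees `≥ 2` -/

section Cover

variable {ι : Type*} {A : Set X} {B : ι → Set X} {c : ι → singularHomology R R ↥A 1}

/-- **Injectivity of the edge `H₁(A ∩ Bᵢ) → H₁(U)` at stage `s ∌ i`** from the independence of
the classes: if `x ↦ 0` then its image in `H₁(A)` lies in `R ∙ cᵢ ∩ span {cⱼ, j ∈ s} = 0`.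
[cite: GompfStipsicz1999, §4.4] -/
theorem injective_edge_of_linearIndependent {Q : Set X} (hAQ : A ⊆ Q) {s : Finset ι} {i : ι}
    (his : i ∉ s)
    (hkF : LinearMap.ker (singularHomology.map R R (subsetInclusion hAQ) 1).hom =
      Submodule.span R (c '' (s : Set ι)))
    (hc : LinearMap.range (singularHomology.map R R
      (subsetInclusion (inter_subset_left : A ∩ B i ⊆ A)) 1).hom = Submodule.span R {c i})
    (hinj : Function.Injective (singularHomology.map R R
      (subsetInclusion (inter_subset_left : A ∩ B i ⊆ A)) 1))
    (hli : LinearIndependent R c) :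
    Function.Injective (singularHomology.map R R
      (subsetInclusion ((inter_subset_left : A ∩ B i ⊆ A).trans hAQ)) 1) := by
  set ι₁ := singularHomology.map R R (subsetInclusion (inter_subset_left : A ∩ B i ⊆ A)) 1
  set F := singularHomology.map R R (subsetInclusion hAQ) 1
  have hfac : singularHomology.map R R
      (subsetInclusion ((inter_subset_left : A ∩ B i ⊆ A).trans hAQ)) 1 = ι₁ ≫ F := by
    rw [← singularHomology.map_comp]; rfl
  rw [hfac]
  show Function.Injective (ι₁ ≫ F).hom
  rw [ModuleCat.hom_comp, injective_iff_map_eq_zero]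
  intro x hx
  have hmem : ι₁.hom x ∈ LinearMap.ker F.hom := hx
  rw [hkF] at hmem
  have hmem' : ι₁.hom x ∈ Submodule.span R (c '' ({i} : Set ι)) := by
    rw [image_singleton, ← hc]; exact LinearMap.mem_range_self _ _
  have hdisj := hli.disjoint_span_image (s := ({i} : Set ι)) (t := (s : Set ι))
    (disjoint_singleton_left.2 (by exact_mod_cast his))
  have h0 : ι₁.hom x = 0 := (Submodule.disjoint_def.1 hdisj) _ hmem' hmem
  exact (injective_iff_map_eq_zero _).1 hinj x h0

/-- **Finset induction over the acyclic pieces**: at every stage `U = A ∪ ⋃_{i ∈ s} Bᵢ`, the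
kernel of `H₁(A) → H₁(U)` is `span {cᵢ, i ∈ s}` and `Hₖ₊₂(A) → Hₖ₊₂(U)` is an isomorphism.
[cite: HatcherAT2002, §2.2 p. 149] -/
theorem ker_and_isIso_finset (hA : IsOpen A) (hB : ∀ i, IsOpen (B i))
    (hdisj : Pairwise fun i j => Disjoint (B i) (B j))
    (hBk : ∀ i k, IsZero (singularHomology R R ↥(B i) (k + 1)))
    (hIk : ∀ i k, IsZero (singularHomology R R ↥(A ∩ B i) (k + 2)))
    (hc : ∀ i, LinearMap.range (singularHomology.map R R
      (subsetInclusion (inter_subset_left : A ∩ B i ⊆ A)) 1).hom = Submodule.span R {c i})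
    (hinj : ∀ i, Function.Injective (singularHomology.map R R
      (subsetInclusion (inter_subset_left : A ∩ B i ⊆ A)) 1))
    (hli : LinearIndependent R c) (s : Finset ι) :
    ∀ (P : Set X) (hP : A ⊆ P), P = A ∪ ⋃ i ∈ s, B i →
      LinearMap.ker (singularHomology.map R R (subsetInclusion hP) 1).hom =
        Submodule.span R (c '' (s : Set ι)) ∧
      ∀ k, IsIso (singularHomology.map R R (subsetInclusion hP) (k + 2)) := by
  classical
  induction s using Finset.induction_on with
  | empty =>
    intro P hP hPe
    have hPA : P ⊆ A := by rw [hPe]; simp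
    rw [Finset.coe_empty, image_empty, Submodule.span_empty]
    refine ⟨LinearMap.ker_eq_bot.2 ((ConcreteCategory.isIso_iff_bijective _).1
      (isIso_map_incl_of_subset R hP hPA 1)).1, fun k => isIso_map_incl_of_subset R hP hPA _⟩
  | @insert i s his ih =>
    intro P hP hPe
    set Q : Set X := A ∪ ⋃ i ∈ s, B i with hQ
    have hAQ : A ⊆ Q := subset_union_left
    obtain rfl : P = Q ∪ B i := by
      rw [hPe, hQ, Finset.set_biUnion_insert]; ac_rfl
    obtain ⟨hkF, hisoF⟩ := ih Q hAQ rfl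
    have hQi : Q ∩ B i = A ∩ B i := by
      rw [hQ, union_inter_distrib_right]
      refine union_eq_left.2 ?_
      rintro a ⟨ha, hai⟩
      obtain ⟨j, hj, haj⟩ := mem_iUnion₂.1 ha
      have hji : j ≠ i := fun e => his (e ▸ hj)
      exact absurd hai (Set.disjoint_left.1 (hdisj hji) haj)
    have hQo : IsOpen Q := hA.union (isOpen_biUnion fun i _ => hB i)
    have hfac : ∀ n, singularHomology.map R R (subsetInclusion hP) n =
        singularHomology.map R R (subsetInclusion hAQ) n ≫
          singularHomology.map R R (subsetInclusion (subset_union_left : Q ⊆ Q ∪ B i)) n :=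
      fun n => by rw [← singularHomology.map_comp]; rfl
    refine ⟨?_, fun k => ?_⟩
    · -- the kernel (as in `surjective_and_ker_finset`)
      have hkG := ker_map_one_union R R hQo (hB i) (hBk i 0)
      have hkG' : LinearMap.ker (singularHomology.map R R
          (subsetInclusion (subset_union_left : Q ⊆ Q ∪ B i)) 1).hom =
          Submodule.map (singularHomology.map R R (subsetInclusion hAQ) 1).hom
            (Submodule.span R {c i}) := by
        rw [hkG, range_congr_set R hQi inter_subset_left (inter_subset_left.trans hAQ) 1,
          hom_comp_incl R (inter_subset_left : A ∩ B i ⊆ A) hAQ 1, LinearMap.range_comp, hc i]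
      rw [hfac, ModuleCat.hom_comp, ker_comp_eq_sup hkF hkG', Finset.coe_insert, image_insert_eq,
        Submodule.span_insert]
    · -- the isomorphism in degree `k + 2`
      haveI : Mono (singularHomology.map R R (subsetInclusion (inter_subset_left :
          Q ∩ B i ⊆ Q)) (k + 1)) := by
        refine mono_map_congr_set R hQi inter_subset_left (inter_subset_left.trans hAQ) _ ?_
        cases k with
        | zero =>
          exact (ModuleCat.mono_iff_injective _).2
            (injective_edge_of_linearIndependent R hAQ his hkF (hc i) (hinj i) hli)
        | succ k => exact ⟨fun _ _ _ => (hIk i k).eq_of_tgt _ _⟩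
      haveI := isIso_map_succ_union R R hQo (hB i) (k + 1)
        (isZero_congr_set R hQi _ (hIk i k)) (hBk i (k + 1))
      haveI := hisoF k
      rw [hfac]
      infer_instance

/-- **`Hₖ₊₂(A; R) ≅ Hₖ₊₂(X; R)` for a space covered by an open piece `A` and finitely many
disjoint acyclic open pieces with independent edge classes** (hypotheses as in the module
docstring). [cite: HatcherAT2002, §2.2 p. 149] [cite: GompfStipsicz1999, §4.4] -/
theorem isIso_map_add_two_cover [Finite ι] (hA : IsOpen A) (hB : ∀ i, IsOpen (B i))
    (hdisj : Pairwise fun i j => Disjoint (B i) (B j)) (hcov : A ∪ ⋃ i, B i = univ)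
    (hBk : ∀ i k, IsZero (singularHomology R R ↥(B i) (k + 1)))
    (hIk : ∀ i k, IsZero (singularHomology R R ↥(A ∩ B i) (k + 2)))
    (hc : ∀ i, LinearMap.range (singularHomology.map R R
      (subsetInclusion (inter_subset_left : A ∩ B i ⊆ A)) 1).hom = Submodule.span R {c i})
    (hinj : ∀ i, Function.Injective (singularHomology.map R R
      (subsetInclusion (inter_subset_left : A ∩ B i ⊆ A)) 1))
    (hli : LinearIndependent R c) (k : ℕ) :
    IsIso (singularHomology.map R R (subsetIncl A) (k + 2)) := by
  classical
  haveI := Fintype.ofFinite ι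
  have hcov' : (univ : Set X) = A ∪ ⋃ i ∈ (Finset.univ : Finset ι), B i := by
    rw [← hcov]; congr 1; ext x; simp
  haveI := ((ker_and_isIso_finset R hA hB hdisj hBk hIk hc hinj hli Finset.univ univ
    (subset_univ A) hcov').2 k)
  haveI := isIso_map_incl_univ R (X := X) (k + 2)
  have hfac : singularHomology.map R R (subsetIncl A) (k + 2) =
      singularHomology.map R R (subsetInclusion (subset_univ A)) (k + 2) ≫
        singularHomology.map R R (subsetIncl (univ : Set X)) (k + 2) := by
    rw [← singularHomology.map_comp]; rfl
  rw [hfac]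
  infer_instance

end Cover

/-! ## §3 The registered sub-goal stub -/

/-- **Cover half of the multi-attachment `Hₖ` engine, `k ≥ 2`** (registered sub-goal stub
`stub_multiAttachment_coverHk` of `stub_isLefschetzHandlebody_homology`): for
`X = A ∪ ⋃ᵢ Bᵢ` with `A`, `Bᵢ` open, the `Bᵢ` pairwise disjoint and acyclic in positive
degrees, `Hₖ(A ∩ Bᵢ) = 0` for `k ≥ 2`, `H₁(A ∩ Bᵢ) → H₁(A)` injective with image `R ∙ cᵢ`, and
`c` linearly independent: `Hₖ₊₂(A; R) → Hₖ₊₂(X; R)` is an isomorphism — for Kosinski's cover of a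
multi-attachment of 2-handles (`A ∩ Bᵢ ≃ S¹`, `Bᵢ ≃ pt`) this is `Hₖ(V ∪ 2-handles) ≅ Hₖ(V)`
(`k ≥ 3` always, `k = 2` for independent attaching classes; Gompf–Stipsicz 1999, §4.4).
[cite: HatcherAT2002, §2.2 p. 149] -/
theorem stub_multiAttachment_coverHk : ∀ (R : Type) [CommRing R] (X : Type) [TopologicalSpace X]
    (ι : Type) [Finite ι] (A : Set X) (B : ι → Set X)
    (c : ι → Literature.AlgebraicTopology.SingularHomology.singularHomology R R ↥A 1),
    IsOpen A → (∀ i, IsOpen (B i)) → Pairwise (fun i j => Disjoint (B i) (B j)) →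
    A ∪ (⋃ i, B i) = Set.univ →
    (∀ i k, CategoryTheory.Limits.IsZero
      (Literature.AlgebraicTopology.SingularHomology.singularHomology R R ↥(B i) (k + 1))) →
    (∀ i k, CategoryTheory.Limits.IsZero
      (Literature.AlgebraicTopology.SingularHomology.singularHomology R R ↥(A ∩ B i) (k + 2))) →
    (∀ i, LinearMap.range (Literature.AlgebraicTopology.SingularHomology.singularHomology.map R R
      (Literature.AlgebraicTopology.SingularHomology.subsetInclusion
        (Set.inter_subset_left : A ∩ B i ⊆ A)) 1).hom = Submodule.span R {c i}) →
    (∀ i, Function.Injective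
      (Literature.AlgebraicTopology.SingularHomology.singularHomology.map R R
        (Literature.AlgebraicTopology.SingularHomology.subsetInclusion
          (Set.inter_subset_left : A ∩ B i ⊆ A)) 1)) →
    LinearIndependent R c →
    ∀ k : ℕ, CategoryTheory.IsIso
      (Literature.AlgebraicTopology.SingularHomology.singularHomology.map R R
        (Literature.AlgebraicTopology.SingularHomology.subsetIncl A) (k + 2)) :=
  fun R _ _ _ _ _ _ _ _ hA hB hdisj hcov hBk hIk hc hinj hli k =>
    isIso_map_add_two_cover R hA hB hdisj hcov hBk hIk hc hinj hli k

end Summit.SmoothPoincare4.SmoothPoincare4.Theorems.AcyclicBisectionExists.ModpBraidOrbits
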